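import Summits.BirchSwinnertonDyer.BirchSwinnertonDyer.Theorems.CumulativeHeegnerLeopoldtCumulativeHeegnerInclusionAtThreeUnrSeriesZeros
import Summits.BirchSwinnertonDyer.BirchSwinnertonDyer.Theorems.CongruentShaFreeCutPadicSupplyRate
import HarnessLib

/-!
# Crux K1 `CumulativeHeegnerInclusionAtThree` (stmt-BirchSwinnertonDyer-24198), line `birth` — STUB A
# (`TemperedHeegnerInclusionAtThree`, crux 26896): domination at the TORSION points of the open disc
# (the finite-order characters of `Γ`) does NOT give divisibility in `Λ^ur = R₀⟦T⟧`

Width seat bsd-line-chl-k1-p1-w2 (`--supports stmt-BirchSwinnertonDyer-24198`); companion of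
`…CumulativeHeegnerInclusionAtThreeUnrSeriesDomination` (divisibility up to `p^μ` ⟺ norm domination on a
DENSE subset of the open unit disc of `ℂ_p`) and of `…UnrSeriesZeros` (values at the torsion points
`ζ − 1`, `ζ ∈ μ_{p^∞}`, PIN an element of `R₀⟦T⟧`).

The line's step (b) reads the additive toric period formula of Liu–Zhang–Zhang «at every FINITE-ORDER
character», and step (c) wants a divisibility `(3^μ · L) ⊆ (g)` in `Λ^ur`. Here: the pointwise bound at the
finite-order characters alone cannot deliver it —

* §1 **`norm_prime_le_of_one_add_pow_eq_one`**: a non-trivial `p`-power root of unity `1 + x ∈ ℂ_p` has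
  `‖x‖ ≥ ‖p‖ = p⁻¹` (by induction on the order, from the tree's `…PadicSupplyRate.norm_one_add_pow_prime_sub_one`:
  for `‖y‖ < ‖p‖`, `‖(1+y)^p − 1‖ = ‖p‖·‖y‖` exactly, so the `p`-power never reaches `1`). In particular the
  torsion points are ISOLATED from the point `T = p²` of the disc.
* §2 **`exists_torsion_dominated_not_mem_span`**: `g = T − p² ≠ 0`, `L = 1` satisfy
  `‖L(ζ − 1)‖ ≤ p² · ‖g(ζ − 1)‖` for EVERY `p`-power root of unity `ζ ∈ ℂ_p`, yet `p^μ · L ∉ (g)` for all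
  `μ` (evaluate at `T = p²`). Compare `…UnrSeriesDomination.exists_C_pow_mul_mem_span_iff_norm_value_le`
  (domination on the whole disc ⟺ divisibility up to `p^μ`).

HONEST FRAMING: pure `p`-adic algebra; nothing about elliptic curves or `L`-functions; closes nothing by
itself. No definition, no named fact, no `sorry`. BSD is not proved by any of this; no summit statement is
proved by this seat.

References: [Washington1997] §5.1 (principal units), §7.1 Thm. 7.3; evidence #28 §3 on
stmt-BirchSwinnertonDyer-24198 (the order-1 gap at the finite-order characters).
-/

set_option autoImplicit false
-- `…BirchSwinnertonDyer.BirchSwinnertonDyer.Theorems…` is the problem's mandated namespace (D-0017).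
set_option linter.dupNamespace false

noncomputable section

open scoped Classical

open Filter Topology PowerSeries Literature.NumberTheory.EllipticCurves
  Summit.BirchSwinnertonDyer.Rank1Residual.X11b.Halves
  Summit.BirchSwinnertonDyer.Rank1Residual.X2.HidaLimitAlgebra
  Summit.BirchSwinnertonDyer.BirchSwinnertonDyer.Theorems.CongruentShaFreeCutUnrSeriesWeierstrass
  Summit.BirchSwinnertonDyer.BirchSwinnertonDyer.Theorems.CumulativeHeegnerInclusionAtThreeUnrSeriesZeros

open Summit.BirchSwinnertonDyer.BirchSwinnertonDyer.Theorems.CongruentShaFreeCutPadicSupplyRate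
  (norm_one_add_pow_prime_sub_one)

namespace Summit.BirchSwinnertonDyer.BirchSwinnertonDyer.Theorems.CumulativeHeegnerInclusionAtThreeUnrSeriesTorsionDomination

variable {p : ℕ} [hp : Fact p.Prime]

/-! ### §1 Principal units: the torsion points `ζ − 1 ≠ 0` have norm `≥ ‖p‖` -/

/-- **A non-trivial `p`-power root of unity `1 + x` of `ℂ_p` has `‖x‖ ≥ ‖p‖`** (the truth is
`‖x‖ = p^{-1/(p^{k-1}(p-1))}`): if `0 < ‖y‖ < ‖p‖` then `‖(1+y)^p − 1‖ = ‖p‖·‖y‖` is again non-zero and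
`< ‖p‖`, so by induction `(1+x)^{p^k} ≠ 1`. [cite: Washington1997, §5.1] -/
theorem norm_prime_le_of_one_add_pow_eq_one {x : ℂ_[p]} {k : ℕ} (h : (1 + x) ^ p ^ k = 1)
    (hx : x ≠ 0) : ‖(p : ℂ_[p])‖ ≤ ‖x‖ := by
  have hp1 : ‖(p : ℂ_[p])‖ < 1 := norm_prime_padicComplex_lt_one
  have hppos : 0 < ‖(p : ℂ_[p])‖ := norm_pos_iff.mpr (by exact_mod_cast hp.out.ne_zero)
  by_contra hlt
  rw [not_le] at hlt
  suffices H : ∀ (k : ℕ) (y : ℂ_[p]), y ≠ 0 → ‖y‖ < ‖(p : ℂ_[p])‖ → (1 + y) ^ p ^ k ≠ 1 from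
    H k x hx hlt h
  intro k
  induction k with
  | zero =>
    intro y hy _ h1
    rw [pow_zero, pow_one, add_eq_left] at h1
    exact hy h1
  | succ k ih =>
    intro y hy hyn h1
    have hnorm : ‖(1 + y) ^ p - 1‖ = ‖(p : ℂ_[p])‖ * ‖y‖ := norm_one_add_pow_prime_sub_one hyn
    have hy'0 : (1 + y) ^ p - 1 ≠ 0 := by
      rw [← norm_pos_iff, hnorm]; exact mul_pos hppos (norm_pos_iff.mpr hy)
    have hy'n : ‖(1 + y) ^ p - 1‖ < ‖(p : ℂ_[p])‖ := by
      rw [hnorm]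
      exact (mul_le_of_le_one_left (norm_nonneg _) hp1.le).trans_lt hyn
    have h2 : (1 + ((1 + y) ^ p - 1)) ^ p ^ k = 1 := by
      rw [add_sub_cancel, ← pow_mul, ← pow_succ']; exact h1
    exact ih _ hy'0 hy'n h2

/-! ### §2 The witness `g = T − p²`, `L = 1` -/

/-- **Domination at every torsion point does NOT give divisibility up to a power of `p`.** There are
`g ≠ 0` and `L` in `R₀⟦T⟧` — namely `g = T − p²`, `L = 1` — with `‖L(ζ − 1)‖ ≤ p² · ‖g(ζ − 1)‖` for EVERY
`p`-power root of unity `ζ ∈ ℂ_p` (every finite-order character of `Γ ≅ ℤ_p`, `1 + T ↔ γ`), and yet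
`p^μ · L ∉ (g)` for all `μ` (evaluate at `T = p²`). So a bound at the finite-order characters only (where
the additive toric period formula of Liu–Zhang–Zhang is printed) cannot by itself yield the divisibility
of stub A; compare `eq_of_hasValueAt_eq_torsionPoints` (values there DO pin the element).
[cite: Washington1997, §7.1 Thm. 7.3] -/
theorem exists_torsion_dominated_not_mem_span :
    ∃ g L : UnrSeries p, g ≠ 0 ∧
      (∀ (x : ℂ_[p]) (k : ℕ), (1 + x) ^ p ^ k = 1 → ∀ u v : ℂ_[p], g.HasValueAt x u →
        L.HasValueAt x v → ‖v‖ ≤ (p : ℝ) ^ 2 * ‖u‖) ∧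
      ¬ ∃ μ : ℕ, PowerSeries.C (((p : ℕ) : unrIntegers p) ^ μ) * L ∈ Ideal.span {g} := by
  have hpR : (1 : ℝ) < p := by exact_mod_cast hp.out.one_lt
  have hp0 : (0 : ℝ) < p := by positivity
  have hpC0 : (p : ℂ_[p]) ≠ 0 := by exact_mod_cast hp.out.ne_zero
  have hnp : ‖(p : ℂ_[p])‖ = (p : ℝ)⁻¹ :=
    Literature.NumberTheory.LFunctions.Dwork.norm_natCast_p_padicComplex
  have hpinv0 : (0 : ℝ) < (p : ℝ)⁻¹ := by positivity
  have hpinv1 : (p : ℝ)⁻¹ < 1 := inv_lt_one_of_one_lt₀ hpR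
  -- the witness `g = T − p²` as (the image of) a polynomial, `L = 1`
  set c : unrIntegers p := ((p : ℕ) : unrIntegers p) ^ 2 with hc
  set G : Polynomial (unrIntegers p) := Polynomial.X - Polynomial.C c with hG
  have hcC : (c : ℂ_[p]) = (p : ℂ_[p]) ^ 2 := coe_natCast_pow 2
  have hnc : ‖(c : ℂ_[p])‖ = ((p : ℝ)⁻¹) ^ 2 := norm_coe_natCast_pow 2
  have hGeval : ∀ x : ℂ_[p], (G.map (unrIntegers p).subtype).eval x = x - (p : ℂ_[p]) ^ 2 := by
    intro x
    rw [hG, Polynomial.map_sub, Polynomial.map_X, Polynomial.map_C, Polynomial.eval_sub,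
      Polynomial.eval_X, Polynomial.eval_C, Subring.subtype_apply, hcC]
  have hGval : ∀ x : ℂ_[p], UnrSeries.HasValueAt (G : UnrSeries p) x (x - (p : ℂ_[p]) ^ 2) := by
    intro x
    rw [← hGeval x]
    exact hasValueAt_coe_polynomial G x
  refine ⟨(G : UnrSeries p), 1, ?_, ?_, ?_⟩
  · -- `g ≠ 0`: its coefficient of `T` is `1`
    intro h0
    have h1 := congrArg (PowerSeries.coeff 1) h0
    rw [Polynomial.coeff_coe, hG, Polynomial.coeff_sub, Polynomial.coeff_X_one, Polynomial.coeff_C,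
      if_neg one_ne_zero, sub_zero, map_zero] at h1
    exact one_ne_zero h1
  · -- domination at the torsion points with constant `p²`
    intro x k hxk u v hu hv
    have hu' : u = x - (p : ℂ_[p]) ^ 2 := hu.unique (hGval x)
    have hv' : v = 1 := hv.unique (hasValueAt_one x)
    rw [hu', hv', norm_one]
    have hnp2 : ‖(p : ℂ_[p]) ^ 2‖ = ((p : ℝ)⁻¹) ^ 2 := by rw [← hcC, hnc]
    by_cases hx0 : x = 0
    · rw [hx0, zero_sub, norm_neg, hnp2, ← mul_pow, mul_inv_cancel₀ hp0.ne', one_pow]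
    · have hgt : ((p : ℝ)⁻¹) ^ 2 < ‖x‖ := by
        refine lt_of_lt_of_le ?_ (hnp ▸ norm_prime_le_of_one_add_pow_eq_one hxk hx0)
        rw [sq]; exact mul_lt_of_lt_one_left hpinv0 hpinv1
      have hne : ‖x‖ ≠ ‖-((p : ℂ_[p]) ^ 2)‖ := by rw [norm_neg, hnp2]; exact hgt.ne'
      have heq : ‖x - (p : ℂ_[p]) ^ 2‖ = ‖x‖ := by
        rw [sub_eq_add_neg, IsUltrametricDist.norm_add_eq_max_of_norm_ne_norm hne, max_eq_left]
        rw [norm_neg, hnp2]; exact hgt.le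
      rw [heq]
      calc (1 : ℝ) = (p : ℝ) ^ 2 * ((p : ℝ)⁻¹) ^ 2 := by
            rw [← mul_pow, mul_inv_cancel₀ hp0.ne', one_pow]
        _ ≤ (p : ℝ) ^ 2 * ‖x‖ := mul_le_mul_of_nonneg_left hgt.le (by positivity)
  · -- no `μ` with `p^μ ∈ (T − p²)`: evaluate at `T = p²`
    rintro ⟨μ, hμ⟩
    obtain ⟨q, hq⟩ := Ideal.mem_span_singleton'.mp hμ
    have hx : ‖(p : ℂ_[p]) ^ 2‖ < 1 := by
      rw [← hcC, hnc]
      exact pow_lt_one₀ hpinv0.le hpinv1 two_ne_zero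
    obtain ⟨w, hw⟩ := exists_hasValueAt q hx
    have h1 : UnrSeries.HasValueAt (q * (G : UnrSeries p)) ((p : ℂ_[p]) ^ 2) (w * 0) := by
      have := hasValueAt_mul hx hw (hGval ((p : ℂ_[p]) ^ 2))
      rwa [sub_self] at this
    have h2 : UnrSeries.HasValueAt (PowerSeries.C (((p : ℕ) : unrIntegers p) ^ μ) * 1) ((p : ℂ_[p]) ^ 2)
        (((((p : ℕ) : unrIntegers p) ^ μ : unrIntegers p) : ℂ_[p]) * 1) :=
      hasValueAt_C_mul _ (hasValueAt_one _)
    rw [hq] at h1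
    have h3 : ((((p : ℕ) : unrIntegers p) ^ μ : unrIntegers p) : ℂ_[p]) * 1 = w * 0 := h2.unique h1
    rw [mul_one, mul_zero, coe_natCast_pow] at h3
    exact pow_ne_zero μ hpC0 h3

end Summit.BirchSwinnertonDyer.BirchSwinnertonDyer.Theorems.CumulativeHeegnerInclusionAtThreeUnrSeriesTorsionDomination

end
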